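import Summits.AtomisticToContinuum.BoseEinsteinCondensation.Theorems.BECCutLineWeakDisorderDefs
import Summits.AtomisticToContinuum.BoseEinsteinCondensation.Theorems.BECCutLineWeakDisorderTaggedShiftDefs
import HarnessLib

/-!
# Route `BECCutLineWeakDisorder`, crux `TwoReplicaTransienceBound` (stmt-AtomisticToContinuum-9687):
# vocabulary and stub statements of the line `across-cut-thinning` (v2, lead c6 reshape)

Route-posited objects (D-0016 `<Route>Defs`-style file; precedents
`Theorems/BECCutLineWeakDisorderDefs.lean` (line `SketchIdeator1`) and
`Theorems/BECCutLineWeakDisorderTaggedShiftDefs.lean` (line `tagged-shift-log-harnack`) of this crux)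
shared by the registered stubs of the checked skeleton
`Cruxes/TwoReplicaTransienceBound/Lines/across_cut_thinning.lean` (line card
`Cruxes/TwoReplicaTransienceBound/Lines/across-cut-thinning.md`, idea card
`Cruxes/TwoReplicaTransienceBound/Ideas/across-cut-thinning.md`, re-read by TRIAGE-r2-3 (γ)) and by the
files that prove / compose them. NOTHING IS ASSERTED here: `sideFactor`, `crossTilt`, `sideWeight`,
`crossFull`, `crossHalf`, `bathTwo`, `partSlice`, `blockAmp`, `meanAmp`, `acrossPR`, `tiltLaplace` are
honest definitions over `GroundStateFeynmanKac*.lean` (`fkWeight`, `fkPartition`, `wienerPaths`), the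
tracer vocabulary of `BECCutLineWeakDisorderDefs.lean` (`taggedBathAction`) and the sibling block
vocabulary (`blockMass`, `levelSq`, `dyadicCube`; `kineticDepth` and the UV statement
`KineticScaleFlatnessBeyond` are REUSED from `BECCutLineWeakDisorderTaggedShiftDefs.lean`, so that the
one within-block flatness object of this crux is typed once for both lines); every `def … : Prop`
below is a *statement* (a registered stub signature), consumed only as the type of a stub theorem or as
a hypothesis of the sorry-free composition of the line
(`Theorems/BECCutLineWeakDisorderAcrossCutCompose.lean`). ONE registered toolbox stub is PROVED here
(`stub_crossTiltCorner`: with both tubes switched off the two-sided tilted mass is the bath-only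
`2T`-bridge mass `∫ Z_n²`).

**The crux** (`Theses/BECCutLineWeakDisorder.lean`, `def TwoReplicaTransienceBound`): for admissible
`v`, `0 < ρ < ρ₀(v)`, some `C`, all large `n` and every half-length `T ≥ 1`, the flat-datum
Feynman–Kac witness `Ψ_T = fkWitness v L T 1` (`L = sideLength ρ (n+1)`) has
`∫ L³ m_T(Y)²/s_T(Y)² dY ≤ C` (`m_T(Y) = ∫Ψ_T(x,Y)²dx`, `s_T(Y) = ∫Ψ_T(x,Y)dx`).

**The line (across-cut tilt identity).** Write the two-replica weight of the CUT world-lines (past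
half-line from `(x, Y)` along a frozen tagged path `ω₀`, future half-line from `(x', Y)` along `ω₀'`,
INDEPENDENT bath histories given the common slice `Y`) as the corner `(s,t) = (1,1)` of the family
`Λ(s,t) = ∫_Y E_Y[w e^{-sA}] E_Y[w e^{-tA'}] dY` (`crossTilt s t 0 0`) in which the two tagged tubes
are switched on at strengths `s, t ∈ [0,1]` (`A, A'` = the bath's dose `taggedBathAction` along the
frozen past / future tagged path). `log Λ` is `C²` with `∂ₛ∂ₜ log Λ = Cov_{s,t}(A,A')`, so a bound
`κ₀` on the tilted across-cut dose covariance closes the connected functional at all orders: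
`Λ(1,1)Λ(0,0) ≤ e^{κ₀} Λ(1,0)Λ(0,1)` (`TiltFTC`, the DEVICE, pure real analysis); integrated over a
block of junctions and over the tagged paths (tracer factorisation + Tonelli) this is the annealed
kinetic-block two-replica bound `∫Z_n² · ∫A_Q² ≤ e^{κ₀} (∫A_Q Z_n)²` (`BlockOfCovarianceReduction`).
From the block bound the crux is reached by kernel-checked bookkeeping plus three declared modules:
flatness of the MEAN insertion profile (`MeanProfileFlat`), a reverse-Hölder bound for the
across-block participation under the broken-line law (`ParticipationTail`), and the shared UV module
`KineticScaleFlatnessBeyond` (beyond the kinetic time; below it the landed mean-free window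
`TracerDecoupling.stub_meanFreeWindow` bounds the crux directly).

**Lead c6 reshape (why v2 differs from the planner's skeleton).** The planner typed the conjecture
item with the tagged–bath coupling TRUNCATED at height `K` and `κ₀` uniform in `K` ("killing-rate
interpolation", to include hard cores). That statement is false for every hard-core `v`: with both
tubes off (`s = t = 0`) the truncated dose is `K ×` (overlap time of the bare bath with the frozen
path), whose across-cut covariance is `K² ×` a fixed positive number. For pure hard cores the tilt
device is in fact EMPTY (the dose is `{0, ∞}`-valued, `Λ` is constant on `(0,1]²`). Hence v2 restricts
the device chain to BOUNDED admissible `v` (no truncation: doses `≤ n‖v‖_∞T`;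
`CrossCovarianceBoundBdd` + `BlockOfCovarianceReduction`) and types the annealed block two-replica
bound DIRECTLY as the conjecture input for unbounded (hard-core type) admissible `v`
(`BlockTwoReplicaBoundSingular`); the composition is by cases on boundedness of `v`.

**Registered stubs** (skeleton `twoReplicaTransienceBound_skeleton`; 2 provable + 5 conjectural + 3
bookkeeping/toolbox): `stub_tiltFTC` (M), `stub_blockOfCovariance` (L: `TiltFTC → BlockOfCovarianceReduction`),
`stub_crossCovarianceBdd`, `stub_blockTwoReplicaSingular`, `stub_meanProfileFlat`,
`stub_participationTail`, `stub_kineticScaleFlatnessBeyond` (the sibling line's typed UV target);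
`stub_crossTiltCorner` (proved HERE), `stub_acrossCutPointwise` (bookkeeping file),
`stub_acrossCutCompose` (the seven statements ⇒ the crux BY NAME, composition file).

References (for the objects, not for any claim): E. Bolthausen, CMP 123 (1989) (two-replica second
moment); F. Comets, N. Yoshida, CMP 254 (2005) (`L²` region of the Brownian directed polymer);
J. Ginibre, CMP 16 (1970) 310–328 (FKG/GHS-type correlation inequalities by duplication — the tilt
family is the duplicated-system generating function read across the cut).
-/

noncomputable section

open MeasureTheory Filter Set Finset
open scoped ENNReal NNReal Topology BigOperators

namespace Summit.AtomisticToContinuum.BoseEinsteinCondensation.Cruxes.TwoReplicaTransienceBound.AcrossCutThinning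

open Literature.MathematicalPhysics.QuantumManyBody.BoseGas
open Summit.AtomisticToContinuum.BoseEinsteinCondensation.Theses.BECCutLineWeakDisorder
open Summit.AtomisticToContinuum.BoseEinsteinCondensation.Cruxes.TwoReplicaTransienceBound.TracerDecoupling
open Summit.AtomisticToContinuum.BoseEinsteinCondensation.Cruxes.TwoReplicaTransienceBound.TaggedShiftLogHarnack
  (kineticDepth KineticScaleFlatnessBeyond)
open Summit.AtomisticToContinuum.BoseEinsteinCondensation.Cruxes.LandscapeBound.SiblingTelescopingChaining

variable {n : ℕ}

/-! ### Objects -/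

/-- One-sided TILTED bath factor `E_Y[w · A^i · e^{-s A}]` (`i ∈ {0,1}`; `w = fkWeight`, the bath's own
killed interacting weight on `[0, T]`; `A = taggedBathAction`, the dose painted on the bath paths by
the FROZEN tagged path `σ ↦ x + √2 b_σ(ω₀)`; the tube is switched on at strength `s`).
`[0,∞]`-valued; for bounded `v` the dose is `≤ n‖v‖_∞T` and nothing is junk. -/
def sideFactor (s : ℝ≥0) (i : ℕ) (v : ℝ → ℝ≥0∞) (L T : ℝ) (x : Space) (Y : Config n)
    (ω₀ : Fin 3 → (ℝ≥0 → ℝ)) : ℝ≥0∞ :=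
  ∫⁻ ωb, fkWeight v L T Y ωb *
      (taggedBathAction v T x Y ω₀ ωb ^ i *
        expNeg ((s : ℝ≥0∞) * taggedBathAction v T x Y ω₀ ωb)) ∂wienerPaths n

/-- Two-sided tilted cross moment `Λ_{s,t}[A^i A'^j] = ∫_Y E_Y[w A^i e^{-sA}] · E_Y[w A'^j e^{-tA'}] dY`:
past tube `(x, ω₀)` at strength `s`, future tube `(x', ω₀')` at strength `t`, INDEPENDENT bath
histories given the slice (across the cut; `Λ_{s,t}[1] = Λ(s,t)`). -/
def crossTilt (s t : ℝ≥0) (i j : ℕ) (v : ℝ → ℝ≥0∞) (L T : ℝ) (x : Space)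
    (ω₀ : Fin 3 → (ℝ≥0 → ℝ)) (x' : Space) (ω₀' : Fin 3 → (ℝ≥0 → ℝ)) : ℝ≥0∞ :=
  ∫⁻ Y : Config n, sideFactor s i v L T x Y ω₀ * sideFactor t j v L T x' Y ω₀'

/-- One-sided bath factor with the tube at FULL strength, `E_Y[w · e^{-A}]`
(`A = taggedBathAction v`, possibly `∞` for hard cores: `e^{-∞} = 0`). -/
def sideWeight (v : ℝ → ℝ≥0∞) (L T : ℝ) (x : Space) (Y : Config n)
    (ω₀ : Fin 3 → (ℝ≥0 → ℝ)) : ℝ≥0∞ :=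
  ∫⁻ ωb, fkWeight v L T Y ωb * expNeg (taggedBathAction v T x Y ω₀ ωb) ∂wienerPaths n

/-- `Λ(1,1)`: both tubes on. -/
def crossFull (v : ℝ → ℝ≥0∞) (L T : ℝ) (x : Space) (ω₀ : Fin 3 → (ℝ≥0 → ℝ)) (x' : Space)
    (ω₀' : Fin 3 → (ℝ≥0 → ℝ)) : ℝ≥0∞ :=
  ∫⁻ Y : Config n, sideWeight v L T x Y ω₀ * sideWeight v L T x' Y ω₀'

/-- `Λ(1,0) = Λ(0,1)`-type factor: one tube on, the other side the bare bath `Z_n(Y)`. -/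
def crossHalf (v : ℝ → ℝ≥0∞) (L T : ℝ) (x : Space) (ω₀ : Fin 3 → (ℝ≥0 → ℝ)) : ℝ≥0∞ :=
  ∫⁻ Y : Config n, sideWeight v L T x Y ω₀ * fkPartition v L T Y

/-- `Λ(0,0) = ∫ Z_n(Y)² dY`: the bath-only `2T`-bridge mass. -/
def bathTwo (v : ℝ → ℝ≥0∞) (L T : ℝ) (n : ℕ) : ℝ≥0∞ :=
  ∫⁻ Y : Config n, fkPartition v L T Y ^ 2

/-- The insertion-profile slice `x ↦ Z_{n+1}(x :: Y)` of the UNNORMALISED partition function. -/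
def partSlice (v : ℝ → ℝ≥0∞) (L T : ℝ) (Y : Config n) : Space → ℝ≥0∞ :=
  fun x => fkPartition v L T (Matrix.vecCons x Y)

/-- Block insertion amplitude `A_Q(Y) = ∫_Q Z_{n+1}(x :: Y) dx` over the dyadic block `Q = (j, i)`. -/
def blockAmp (v : ℝ → ℝ≥0∞) (L T : ℝ) (j : ℕ) (i : Fin 3 → Fin (2 ^ j)) (Y : Config n) : ℝ≥0∞ :=
  blockMass (partSlice v L T Y) L j i

/-- Mean insertion amplitude of the block, `B_Q = ∫ A_Q(Y) Z_n(Y) dY` (past half-line inserted in `Q`,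
future side the bare bath). -/
def meanAmp (v : ℝ → ℝ≥0∞) (L T : ℝ) (j : ℕ) (i : Fin 3 → Fin (2 ^ j)) (n : ℕ) : ℝ≥0∞ :=
  ∫⁻ Y : Config n, blockAmp v L T j i Y * fkPartition v L T Y

/-- **Across-block (infrared) participation at depth `K`**: `R_IR,K(g) = 8^K S_K(g)/(∫ g)²`
(`S_K = Σ_Q a_Q² = levelSq`; `∈ [1, 8^K]` off junk values). With `r̄_K = uvParticipation`,
`L³ (∫g²)/(∫g)² = r̄_K · R_IR,K`. -/
def acrossPR (g : Space → ℝ≥0∞) (L : ℝ) (K : ℕ) : ℝ≥0∞ :=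
  8 ^ K * levelSq g L K / (∫⁻ x, g x) ^ 2

/-- Tilted Laplace moments of an abstract pair `(A, A')` on a measure space:
`M(s,t;i,j) = ∫ A^i A'^j e^{-(sA + tA')} dμ` (Bochner integral, real-valued). -/
def tiltLaplace {Ω : Type*} [MeasurableSpace Ω] (μ : Measure Ω) (A A' : Ω → ℝ) (s t : ℝ)
    (i j : ℕ) : ℝ :=
  ∫ ω, A ω ^ i * A' ω ^ j * Real.exp (-(s * A ω + t * A' ω)) ∂μ

/-! ### The statements of the line -/

/-- STUB `stub_tiltFTC` — **the device (abstract): a bound on the tilted covariance closes the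
connected functional at all orders, constant `e^{B}`.** On a finite measure space, for bounded
measurable `A, A' ≥ 0`, with `Λ(s,t) = ∫e^{-sA-tA'}`: if `Cov_{μ_{s,t}}(A,A') ≤ B` for all
`(s,t) ∈ [0,1]²` (written multiplicatively, `M₁₁M₀₀ ≤ M₁₀M₀₁ + B·M₀₀²`), then
`Λ(1,1)Λ(0,0) ≤ e^{B} Λ(1,0)Λ(0,1)`. Proof: for `μ ≠ 0` all `M₀₀ > 0`; `s ↦ -M₀₁/M₀₀ (s,t)` has
derivative `(M₁₁M₀₀ − M₁₀M₀₁)/M₀₀² ≤ B` (differentiation under the integral sign, bounded integrands),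
so `E_{0,t}[A'] − E_{1,t}[A'] ≤ B` (mean value inequality); and `t ↦ log Λ(1,t) − log Λ(0,t)` has
derivative `E_{0,t}[A'] − E_{1,t}[A'] ≤ B`, so its increment over `[0,1]` is `≤ B`; `μ = 0` is
`0 ≤ 0`. Pure Mathlib real analysis (M). -/
def TiltFTC : Prop :=
  ∀ (Ω : Type) [MeasurableSpace Ω] (μ : Measure Ω) [IsFiniteMeasure μ] (A A' : Ω → ℝ),
    Measurable A → Measurable A' → (∀ ω, 0 ≤ A ω) → (∀ ω, 0 ≤ A' ω) →
    (∃ M : ℝ, ∀ ω, A ω ≤ M ∧ A' ω ≤ M) → ∀ B : ℝ, 0 ≤ B →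
    (∀ s t : ℝ, 0 ≤ s → s ≤ 1 → 0 ≤ t → t ≤ 1 →
      tiltLaplace μ A A' s t 1 1 * tiltLaplace μ A A' s t 0 0 ≤
        tiltLaplace μ A A' s t 1 0 * tiltLaplace μ A A' s t 0 1 +
          B * tiltLaplace μ A A' s t 0 0 ^ 2) →
    tiltLaplace μ A A' 1 1 0 0 * tiltLaplace μ A A' 0 0 0 0 ≤
      Real.exp B * (tiltLaplace μ A A' 1 0 0 0 * tiltLaplace μ A A' 0 1 0 0)

/-- STUB `stub_crossCovarianceBdd` — **the conjecture ITEM of the line for BOUNDED admissible `v`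
(tilt-uniform across-cut dose covariance bound, (H-IR) type).** For admissible bounded `v`,
`ρ < ρ₀(v)`, some `κ₀ = κ₀(v,ρ) < ∞`, eventually in `n`, for all `T ≥ 1`, all tilts
`s, t ∈ [0,1]`, all junctions `x, x'` and ALL frozen tagged path pairs:
`Cov_{s,t}(A, A') ≤ κ₀`, i.e. `Λ[AA']Λ[1] ≤ Λ[A]Λ[A'] + κ₀ Λ[1]²` for the two-sided tilted law
(past tube × future tube, independent bath histories given the slice; doses `A, A' ≤ n‖v‖_∞T`, no
truncation). WHY FINITE: given the slice the two doses are independent, so the covariance is that of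
the CONDITIONAL mean doses over the slice law — `∫₀ᵀ∫₀ᵀ dσ dτ` of the connected correlation of the
`v`-smeared bath density at a past point at depth `σ` and a future point at depth `τ`; bounding it by
its sup over positions `Γ(σ + τ)` gives `Cov ≤ ∫₀^{2T} u Γ(u) du` uniformly in the (continuous)
paths — finite iff the bath's imaginary-time density correlation has a finite first time-moment
(phonons: `Γ(u) ≍ u⁻⁴`, Bogoliubov value `κ₀ ≈ (8/√π)√(ρa³)`), INFINITE for an ideal bath
(`Γ ≍ u^{-3/2}`). WHY IT MIGHT FAIL: BEC-strength (through the exact chain of this line it gives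
block-level ODLRO of the witness); uniform clustering of the dilute gas perturbed by two bounded
repulsive tubes is conjectural; per box and for the free gas (`κ₀ = 0`, equality) it holds. Sign-free
and allowance-free on purpose (TRIAGE-r2: the `K = 1`/sign form is false); bounded `v` on purpose
(lead c6: the `K`-truncated form is false for hard cores, see the module docstring). -/
def CrossCovarianceBoundBdd : Prop :=
  ∀ v : ℝ → ℝ≥0∞, IsRepulsiveFiniteRange v → (∃ C : ℝ≥0, ∀ r, v r ≤ C) →
    ∃ ρ₀ : ℝ, 0 < ρ₀ ∧ ∀ ρ : ℝ, 0 < ρ → ρ < ρ₀ →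
      ∃ κ₀ : ℝ, 0 ≤ κ₀ ∧ ∀ᶠ n : ℕ in atTop, ∀ T : ℝ, 1 ≤ T →
        ∀ (s t : ℝ≥0), s ≤ 1 → t ≤ 1 → ∀ (x x' : Space) (ω₀ ω₀' : Fin 3 → (ℝ≥0 → ℝ)),
          crossTilt (n := n) s t 1 1 v (sideLength ρ (n + 1)) T x ω₀ x' ω₀' *
              crossTilt (n := n) s t 0 0 v (sideLength ρ (n + 1)) T x ω₀ x' ω₀' ≤
            crossTilt (n := n) s t 1 0 v (sideLength ρ (n + 1)) T x ω₀ x' ω₀' *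
                crossTilt (n := n) s t 0 1 v (sideLength ρ (n + 1)) T x ω₀ x' ω₀' +
              ENNReal.ofReal κ₀ *
                crossTilt (n := n) s t 0 0 v (sideLength ρ (n + 1)) T x ω₀ x' ω₀' ^ 2

/-- STUB target of `stub_blockOfCovariance` — **from the tilt-uniform covariance bound to the
annealed block two-replica bound** (per parameter; bounded measurable `v`, `L > 0`, `T ≥ 0`,
`κ₀ ≥ 0`): IF the covariance bound holds at all tilts in `[0,1]²`, all junctions and all frozen
path pairs, THEN for every dyadic block `Q`, `(∫ Z_n² dY)·∫ A_Q(Y)² dY ≤ e^{κ₀} (∫ A_Q Z_n dY)²`.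
Proof: (1) pathwise four-point inequality `Λ(1,1)·Λ(0,0) ≤ e^{κ₀} Λ(1,0)·Λ(0,1)` — realise
`crossTilt` as `tiltLaplace` on the finite measure space `(Y, ωb, ωb') ∼ w(Y,ωb) w(Y,ωb') dY dW dW`
with the bounded doses (Tonelli; joint measurability of the tagged–bath action) and apply `TiltFTC`;
(2) `Z_{n+1}(x::Y) = ∫ w · tracer` (`stub_factorisation`, landed) and
`tracer = ∫_{ω₀} 𝟙_{surv} e^{-A}`, so `A_Q(Y) = ∫_Q dx ∫ dW(ω₀) 𝟙_{surv}(x,ω₀) · E_Y[w e^{-A(x,ω₀)}]`;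
hence `∫ A_Q² dY` (resp. `∫ A_Q Z_n`) is the `dx dW 𝟙 ⊗ dx' dW' 𝟙`-integral of `Λ(1,1)` (resp. the
`dx dW 𝟙`-integral of `Λ(1,0)`) and (1) integrates (Tonelli). Size L. -/
def BlockOfCovarianceReduction : Prop :=
  ∀ (n : ℕ) (v : ℝ → ℝ≥0∞), Measurable v → (∃ C : ℝ≥0, ∀ r, v r ≤ C) →
    ∀ (L T : ℝ), 0 < L → 0 ≤ T → ∀ κ₀ : ℝ, 0 ≤ κ₀ →
    (∀ (s t : ℝ≥0), s ≤ 1 → t ≤ 1 → ∀ (x x' : Space) (ω₀ ω₀' : Fin 3 → (ℝ≥0 → ℝ)),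
      crossTilt (n := n) s t 1 1 v L T x ω₀ x' ω₀' * crossTilt (n := n) s t 0 0 v L T x ω₀ x' ω₀' ≤
        crossTilt (n := n) s t 1 0 v L T x ω₀ x' ω₀' * crossTilt (n := n) s t 0 1 v L T x ω₀ x' ω₀' +
          ENNReal.ofReal κ₀ * crossTilt (n := n) s t 0 0 v L T x ω₀ x' ω₀' ^ 2) →
    ∀ (j : ℕ) (i : Fin 3 → Fin (2 ^ j)),
      bathTwo v L T n * ∫⁻ Y : Config n, blockAmp v L T j i Y ^ 2 ≤
        ENNReal.ofReal (Real.exp κ₀) * meanAmp v L T j i n ^ 2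

/-- STUB `stub_blockTwoReplicaSingular` — **the conjecture input for UNBOUNDED admissible `v`
(hard-core type): the annealed kinetic-block two-replica bound, typed directly.** For admissible `v`
that is not bounded, every kinetic constant `κ > 0`, `ρ < ρ₀`, some `c`, eventually in `n`, all
`T ≥ 1` and every block `Q` of the kinetic depth `K = kineticDepth κ ρ L`:
`(∫ Z_n² dY)·∫ A_Q(Y)² dY ≤ c (∫ A_Q Z_n dY)²` — the block insertion amplitude ratio
`α_Q(Y) = A_Q(Y)/Z_n(Y) = ∫_Q E[tracer(x) | Y] dx` has second moment `≤ c ×` squared mean under the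
bath bridge slice law `∝ Z_n(Y)² dY`. For the free gas equality with `c = 1` (`A_Q = a_Q Z_n`). WHY
PLAUSIBLE: the slice dependence of `α_Q` is carried by the bath near `Q` at early times (local
crowding; hard cores shadow Smoluchowski sausages), the long-time decay rate being slice-independent.
WHY IT MIGHT FAIL: it is block-level ODLRO of the witness — BEC-strength — with no device of this
line acting on it (for pure hard cores the tilt device is empty: the dose is `{0,∞}`-valued); it is
the docking target of the sibling IR cards (kinetic-block-bolthausen's `CoarseSecondMoment`,
slice-tensorisation). Restricted to unbounded `v` so that it is not idle next to
`CrossCovarianceBoundBdd`. -/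
def BlockTwoReplicaBoundSingular : Prop :=
  ∀ v : ℝ → ℝ≥0∞, IsRepulsiveFiniteRange v → (¬ ∃ C : ℝ≥0, ∀ r, v r ≤ C) →
    ∀ κ : ℝ, 0 < κ → ∃ ρ₀ : ℝ, 0 < ρ₀ ∧ ∀ ρ : ℝ, 0 < ρ → ρ < ρ₀ →
      ∃ c : ℝ, 0 < c ∧ ∀ᶠ n : ℕ in atTop, ∀ T : ℝ, 1 ≤ T →
        ∀ i : Fin 3 → Fin (2 ^ kineticDepth κ ρ (sideLength ρ (n + 1))),
          bathTwo v (sideLength ρ (n + 1)) T n *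
              ∫⁻ Y : Config n,
                blockAmp v (sideLength ρ (n + 1)) T (kineticDepth κ ρ (sideLength ρ (n + 1))) i Y ^ 2 ≤
            ENNReal.ofReal c *
              meanAmp v (sideLength ρ (n + 1)) T (kineticDepth κ ρ (sideLength ρ (n + 1))) i n ^ 2

/-- STUB `stub_meanProfileFlat` — **the MEAN insertion profile is spread over the box (module).**
For admissible `v` and every `κ > 0`: `ρ < ρ₀`, eventually in `n`, uniformly in `T ≥ 1`, the
across-block participation of the deterministic block profile `Q ↦ B_Q = ∫ A_Q Z_n dY` at the kinetic
depth is bounded: `R* = 8^K Σ_Q B_Q²/(Σ_Q B_Q)² ≤ C₁`. `B_Q` is the one-point insertion amplitude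
`⟨e^{-TH_{n+1}}1, 𝟙_Q ⊗ e^{-TH_n}1⟩`; by Cauchy–Schwarz over blocks `R*` is at most the continuum
participation `L³∫b²/(∫b)²` of the profile `b(x) = ∫ Z_{n+1}(x::Y)Z_n(Y)dY`, flat in the bulk by
homogeneity of a one-point function; the content is the wall layer (healing, no binding). Free gas:
`R* ≤ (π²/8)³`. WHY IT MIGHT FAIL: an anomalous wall enhancement of the insertion amplitude
uniformly in `n` (no rigorous density / order-parameter profile for the Dirichlet dilute gas). -/
def MeanProfileFlat : Prop :=
  ∀ v : ℝ → ℝ≥0∞, IsRepulsiveFiniteRange v → ∀ κ : ℝ, 0 < κ → ∃ ρ₀ : ℝ, 0 < ρ₀ ∧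
    ∀ ρ : ℝ, 0 < ρ → ρ < ρ₀ → ∃ C₁ : ℝ, 0 < C₁ ∧ ∀ᶠ n : ℕ in atTop, ∀ T : ℝ, 1 ≤ T →
      (8 : ℝ≥0∞) ^ kineticDepth κ ρ (sideLength ρ (n + 1)) *
          ∑ i : Fin 3 → Fin (2 ^ kineticDepth κ ρ (sideLength ρ (n + 1))),
            meanAmp v (sideLength ρ (n + 1)) T (kineticDepth κ ρ (sideLength ρ (n + 1))) i n ^ 2 ≤
        ENNReal.ofReal C₁ *
          (∑ i : Fin 3 → Fin (2 ^ kineticDepth κ ρ (sideLength ρ (n + 1))),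
            meanAmp v (sideLength ρ (n + 1)) T (kineticDepth κ ρ (sideLength ρ (n + 1))) i n) ^ 2

/-- STUB `stub_participationTail` — **no heavy tail of the across-block participation under the
BROKEN-line bridge law (module; the rare-slice / Lifshitz-void input).** Under `ν₂ ∝ s_Φ(Y)² dY`
(`s_Φ(Y) = ∫ Z_{n+1}(x::Y) dx`: slice law of the `2T`-bridge with the tagged line CUT at the slice) the
kinetic-scale across-block participation `R_IR,K ∈ [1, 8^K]` of the insertion profile
`x ↦ Z_{n+1}(x::Y)` obeys the reverse-Hölder bound `E_{ν₂}[R_IR⁶] ≤ C₂ (E_{ν₂}[R_IR])⁶`, uniformly in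
`n` (eventually) and `T ≥ 1`, for every `κ > 0` (division-free form). Free gas: equality, `C₂ = 1`
(`R_IR` deterministic). WHY PLAUSIBLE: slices on which the insertion profile concentrates on few
kinetic blocks are voids of the bath, super-polynomially rare against the polynomial range `8^K`. WHY
IT MIGHT FAIL: enhanced large-scale collective fluctuations of the slice law uniformly in `n`. -/
def ParticipationTail : Prop :=
  ∀ v : ℝ → ℝ≥0∞, IsRepulsiveFiniteRange v → ∀ κ : ℝ, 0 < κ → ∃ ρ₀ : ℝ, 0 < ρ₀ ∧
    ∀ ρ : ℝ, 0 < ρ → ρ < ρ₀ → ∃ C₂ : ℝ, 0 < C₂ ∧ ∀ᶠ n : ℕ in atTop, ∀ T : ℝ, 1 ≤ T →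
      (∫⁻ Y : Config n, (∫⁻ x, partSlice v (sideLength ρ (n + 1)) T Y x) ^ 2) ^ 5 *
          ∫⁻ Y : Config n, (∫⁻ x, partSlice v (sideLength ρ (n + 1)) T Y x) ^ 2 *
            acrossPR (partSlice v (sideLength ρ (n + 1)) T Y) (sideLength ρ (n + 1))
              (kineticDepth κ ρ (sideLength ρ (n + 1))) ^ 6 ≤
        ENNReal.ofReal C₂ *
          (∫⁻ Y : Config n, (∫⁻ x, partSlice v (sideLength ρ (n + 1)) T Y x) ^ 2 *
            acrossPR (partSlice v (sideLength ρ (n + 1)) T Y) (sideLength ρ (n + 1))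
              (kineticDepth κ ρ (sideLength ρ (n + 1)))) ^ 6

/-! ### Audit aliases (= the registered stub signatures, matched BY NAME by the skeleton audit) -/

namespace Goal

/-- Registered stub `stub_tiltFTC` (the device, abstract; M). -/
abbrev stub_tiltFTC : Prop := TiltFTC

/-- Registered stub `stub_blockOfCovariance` (L): the device instantiated on the two-sided bath space
and integrated over a block of junctions and the tagged paths. -/
abbrev stub_blockOfCovariance : Prop := TiltFTC → BlockOfCovarianceReduction

/-- Registered stub `stub_crossCovarianceBdd` (the conjecture ITEM, bounded `v`; BEC-strength). -/
abbrev stub_crossCovarianceBdd : Prop := CrossCovarianceBoundBdd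

/-- Registered stub `stub_blockTwoReplicaSingular` (the conjecture input, unbounded `v`; BEC-strength). -/
abbrev stub_blockTwoReplicaSingular : Prop := BlockTwoReplicaBoundSingular

/-- Registered stub `stub_meanProfileFlat` (module). -/
abbrev stub_meanProfileFlat : Prop := MeanProfileFlat

/-- Registered stub `stub_participationTail` (module). -/
abbrev stub_participationTail : Prop := ParticipationTail

/-- Registered stub `stub_kineticScaleFlatnessBeyond` (the shared UV module: VERBATIM the sibling
line's typed target `TaggedShiftLogHarnack.KineticScaleFlatnessBeyond`, so whatever closes
`tagged-shift-log-harnack`'s lever chain closes this stub by `id`). -/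
abbrev stub_kineticScaleFlatnessBeyond : Prop := KineticScaleFlatnessBeyond

/-- Registered toolbox stub `stub_crossTiltCorner` (proved below): with both tubes off, the
two-sided tilted mass is the bath-only `2T`-bridge mass, `Λ_{0,0}[1] = ∫ Z_n²`. -/
abbrev stub_crossTiltCorner : Prop :=
  ∀ (n : ℕ) (v : ℝ → ℝ≥0∞) (L T : ℝ) (x : Space) (ω₀ : Fin 3 → (ℝ≥0 → ℝ)) (x' : Space)
    (ω₀' : Fin 3 → (ℝ≥0 → ℝ)),
    crossTilt (n := n) 0 0 0 0 v L T x ω₀ x' ω₀' = bathTwo v L T n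

end Goal

/-! ### The toolbox stub proved in this file -/

/-- With the tube switched off and no dose insertion, the one-sided factor is the bare bath
partition function: `sideFactor 0 0 = Z_n(Y)` (`A⁰ = 1`, `e^{-0·A} = 1`, also when `A = ∞`). -/
theorem sideFactor_zero_zero (v : ℝ → ℝ≥0∞) (L T : ℝ) (x : Space) (Y : Config n)
    (ω₀ : Fin 3 → (ℝ≥0 → ℝ)) : sideFactor 0 0 v L T x Y ω₀ = fkPartition v L T Y := by
  unfold sideFactor fkPartition fkSemigroup
  refine lintegral_congr fun ωb => ?_
  simp only [pow_zero, ENNReal.coe_zero, zero_mul, expNeg_zero, mul_one]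

/-- PROVED toolbox stub `stub_crossTiltCorner`: `Λ_{0,0}[1] = ∫ Z_n(Y)² dY = bathTwo`. -/
theorem stub_crossTiltCorner : Goal.stub_crossTiltCorner := by
  intro n v L T x ω₀ x' ω₀'
  unfold crossTilt bathTwo
  refine lintegral_congr fun Y => ?_
  rw [sideFactor_zero_zero, sideFactor_zero_zero, sq]


/-! ### Appendix (lead c6, v3 statement hygiene): the unbounded class read on `[0, ∞)` -/

/-- STUB `stub_blockTwoReplicaUnbounded` — **v3 form of the conjecture input for unbounded `v`**: the
annealed kinetic-block two-replica bound of `BlockTwoReplicaBoundSingular`, for admissible `v` that is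
unbounded ON THE PHYSICAL DOMAIN `[0, ∞)` (`¬ ∃ C, ∀ r ≥ 0, v r ≤ C`). Every Feynman–Kac object sees
`v` only through `v ∘ dist`, i.e. on `[0, ∞)` (`BlockSingularFree.fkPartition_congr_nonneg` etc.), so
the v2 class `¬ ∃ C, ∀ r, v r ≤ C` was idle on `(-∞, 0)` (it contains FK-free potentials such as
`⊤ · 𝟙_{(-∞,0)}`, audit of `…AcrossCutBlockSingularFree.lean`): the by-cases composition of the line
splits on boundedness ON `[0, ∞)` instead, runs the tilt device on the bounded modification
`r ↦ if 0 ≤ r then v r else 0` in the bounded branch, and consumes THIS statement in the other.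
`BlockTwoReplicaBoundSingular → BlockTwoReplicaBoundUnbounded` (the hypothesis got stronger). Same
plausibility / BEC-strength discussion as `BlockTwoReplicaBoundSingular`. -/
def BlockTwoReplicaBoundUnbounded : Prop :=
  ∀ v : ℝ → ℝ≥0∞, IsRepulsiveFiniteRange v → (¬ ∃ C : ℝ≥0, ∀ r, 0 ≤ r → v r ≤ C) →
    ∀ κ : ℝ, 0 < κ → ∃ ρ₀ : ℝ, 0 < ρ₀ ∧ ∀ ρ : ℝ, 0 < ρ → ρ < ρ₀ →
      ∃ c : ℝ, 0 < c ∧ ∀ᶠ n : ℕ in atTop, ∀ T : ℝ, 1 ≤ T →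
        ∀ i : Fin 3 → Fin (2 ^ kineticDepth κ ρ (sideLength ρ (n + 1))),
          bathTwo v (sideLength ρ (n + 1)) T n *
              ∫⁻ Y : Config n,
                blockAmp v (sideLength ρ (n + 1)) T (kineticDepth κ ρ (sideLength ρ (n + 1))) i Y ^ 2 ≤
            ENNReal.ofReal c *
              meanAmp v (sideLength ρ (n + 1)) T (kineticDepth κ ρ (sideLength ρ (n + 1))) i n ^ 2

/-- The v2 statement implies the v3 statement (its hypothesis is weaker). -/
theorem blockTwoReplicaBoundUnbounded_of_singular (h : BlockTwoReplicaBoundSingular) :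
    BlockTwoReplicaBoundUnbounded :=
  fun v hv hub => h v hv fun ⟨C, hC⟩ => hub ⟨C, fun r _ => hC r⟩

namespace Goal

/-- Registered stub `stub_blockTwoReplicaUnbounded` (v3 conjecture input for `v` unbounded on `[0,∞)`). -/
abbrev stub_blockTwoReplicaUnbounded : Prop := BlockTwoReplicaBoundUnbounded

end Goal

end Summit.AtomisticToContinuum.BoseEinsteinCondensation.Cruxes.TwoReplicaTransienceBound.AcrossCutThinning

end
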